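import Mathlib.FieldTheory.KummerExtension
import Mathlib.FieldTheory.Finite.Basic
import Mathlib.NumberTheory.NumberField.Ideal.Basic
import Mathlib.RingTheory.Valuation.ValuationSubring
import Mathlib.RingTheory.DedekindDomain.Ideal.Lemmas
import HarnessLib

/-!
# Neukirch–Uchida from Neukirch's containment: the Kummer package (sub-DAG row R8)

Topic `NumberTheory/GaloisRepresentations`; namespace
`Literature.NumberTheory.GaloisRepresentations.NeukirchUchidaProof`.  PROOF-ONLY file: theorems
only (no definition, no instance, no named fact); Mathlib-only inputs.  Written for the abc-iut cell's
GAP-LEDGER row G-L4d2g4-1 (campaign L: the Neukirch–Uchida theorem, [NSW] (12.2.1), deduced from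
Neukirch's containment theorem (12.1.9)), sub-DAG `plan/L4/SUBDAG-NeukirchUchida.md` row **R8 KUMMER
PACKAGE**, in the Γ-level currency of its §INTERFACES v2 (a group `G` acting on a field `Ω` by
ring automorphisms — e.g. `G = Gal(Ω/ℚ)`, `Ω = \bar ℚ` —, valuation subrings `A ⊆ Ω` with their
decomposition groups `Stab_G(A)` under Mathlib's pointwise action, and «`x ≡ y (mod 𝔪_A)`» spelled
`x - y ∈ A.nonunits`).  The package is the elementary Kummer-theoretic input of the «Kummer
separation» step R9 (which replaces Uchida's Gassmann argument): for a finite Galois `N/ℚ` containing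
`μ_ℓ` and `β ∈ 𝓞_N` chosen by the Chinese remainder theorem, the decomposition groups in
`Gal(N(β_g^{1/ℓ} : g)/N)` of the primes over a totally split `p` are read off from Kummer characters.

Contents (classical: Neukirch, *Algebraic Number Theory* I §9–10, IV §3, V §3; Serre, *Local Fields*
I §7–8): (a) roots of unity modulo an ideal prime to `ℓ` in a domain (`pow_eq_one_of_pow_sub_one_mem`,
`exists_sub_pow_mul_mem_of_pow_sub_pow_mem`, `exists_eq_pow_mul_of_pow_eq_pow`); (b) Kummer characters
over a field `N ∋ ζ_ℓ` (`exists_algEquiv_apply_eq_pow_smul`, `mul_apply_eq_mul_smul`, joint injectivity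
`algEquiv_eq_one_of_forall_apply_eq`); (c) the Γ-level statements at a valuation subring `A` with
`σ ∈ Stab_G(A)`: (K2) `exists_smul_eq_pow_mul`, (K3) FIXEDNESS
`smul_eq_self_of_pow_eq_of_sub_one_mem_nonunits`, (K3′) MOVING `smul_ne_self_of_sub_pow_mem_nonunits`;
(d) (K4) supply of `β ∈ 𝓞 N`: `exists_pow_div_sub_one_not_mem` (a unit residue with
`t^{(N𝔮-1)/ℓ} ≢ 1`), `exists_forall_sub_mem_of_isMaximal` (CRT with targets),
`coe_sub_mem_nonunits_of_sub_mem`.  Finite-level twins (decomposition groups `Stab(𝔔) ≤ M ≃ₐ[N] M`,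
Frobenius surjectivity): `NeukirchUchidaKummerFiniteLevel.lean`.

HONEST FRAMING: classical algebraic number theory (our kernel check); nothing here bears on
[IUTchIII] Cor. 3.12; no side taken.

## References
* J. Neukirch, A. Schmidt, K. Wingberg, *Cohomology of Number Fields* (2008), (12.2.1). [NeukirchSchmidtWingberg2008]
* J. Neukirch, *Algebraic Number Theory* (1999), I §9–§10, IV §3, V §3. [NeukirchANT1999]
* J.-P. Serre, *Local Fields* (1979), Ch. I §7–§8. [SerreLocalFields1979]
-/

open scoped Pointwise NumberField
open Polynomial
namespace Literature.NumberTheory.GaloisRepresentations.NeukirchUchidaProof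
/-! ### Roots of unity modulo an ideal prime to `ℓ` -/

section RootsOfUnity

variable {R : Type*} [CommRing R] [IsDomain R] {ℓ : ℕ} {ζ : R}

/-- **Roots of unity are distinct modulo ideals prime to `ℓ`.**  If `ζ` is a primitive `ℓ`-th root
of unity (`ℓ` prime) in a domain `R` and `ζ ^ j ≡ 1 (mod I)` for an ideal `I ∌ ℓ`, then `ζ ^ j = 1`:
otherwise `ζ ^ j` is again primitive, `∑_{i<ℓ} ζ^{ji} = 0`, while `ζ^{ji} ≡ 1` forces the sum to be
`≡ ℓ (mod I)` (Neukirch, *Algebraic Number Theory*, I §10, proof of (10.4): `X^ℓ - 1` is separable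
modulo primes not dividing `ℓ`). [cite: NeukirchANT1999, Ch. I §10 Prop. (10.4)] -/
theorem pow_eq_one_of_pow_sub_one_mem (hℓ : ℓ.Prime) (hζ : IsPrimitiveRoot ζ ℓ) {I : Ideal R}
    (hI : (ℓ : R) ∉ I) {j : ℕ} (h : ζ ^ j - 1 ∈ I) : ζ ^ j = 1 := by
  by_contra hne
  -- `μ := ζ ^ j` is again a primitive `ℓ`-th root of unity
  have hcop : j.Coprime ℓ := by
    rw [Nat.coprime_comm, Nat.Prime.coprime_iff_not_dvd hℓ]
    rintro ⟨c, rfl⟩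
    exact hne (by rw [pow_mul, hζ.pow_eq_one, one_pow])
  have hμ : IsPrimitiveRoot (ζ ^ j) ℓ := hζ.pow_of_coprime j hcop
  -- `∑_{i<ℓ} μ^i = 0`, but `μ ≡ 1 (mod I)` forces `∑ μ^i ≡ ℓ (mod I)`
  have hsum : ∑ i ∈ Finset.range ℓ, (ζ ^ j) ^ i = 0 := hμ.geom_sum_eq_zero hℓ.one_lt
  have hmod : ∀ i : ℕ, (ζ ^ j) ^ i - 1 ∈ I := by
    intro i
    obtain ⟨c, hc⟩ := sub_one_dvd_pow_sub_one (ζ ^ j) i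
    rw [hc]
    exact I.mul_mem_right c h
  have hdiff : (∑ i ∈ Finset.range ℓ, (ζ ^ j) ^ i) - (ℓ : R) ∈ I := by
    have : (∑ i ∈ Finset.range ℓ, (ζ ^ j) ^ i) - (ℓ : R) =
        ∑ i ∈ Finset.range ℓ, ((ζ ^ j) ^ i - 1) := by
      rw [Finset.sum_sub_distrib, Finset.sum_const, Finset.card_range, nsmul_eq_mul, mul_one]
    rw [this]
    exact I.sum_mem fun i _ => hmod i
  rw [hsum, zero_sub, I.neg_mem_iff] at hdiff
  exact hI hdiff

/-- `ζ ≢ 1 (mod I)` for a primitive `ℓ`-th root of unity `ζ` and an ideal `I ∌ ℓ` (case `j = 1` of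
`pow_eq_one_of_pow_sub_one_mem`). [cite: NeukirchANT1999, Ch. I §10 Prop. (10.4)] -/
theorem sub_one_not_mem (hℓ : ℓ.Prime) (hζ : IsPrimitiveRoot ζ ℓ) {I : Ideal R}
    (hI : (ℓ : R) ∉ I) : ζ - 1 ∉ I := fun h => hζ.ne_one hℓ.one_lt <| by
  simpa using pow_eq_one_of_pow_sub_one_mem hℓ hζ hI (j := 1) (by rwa [pow_one])

/-- **`ℓ`-th roots modulo a prime differ by a root of unity**: if `x ^ ℓ ≡ y ^ ℓ (mod 𝔓)` for a
prime ideal `𝔓` of a domain containing a primitive `ℓ`-th root of unity `ζ`, then `x ≡ ζ ^ k y (mod 𝔓)`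
for some `k < ℓ` (`X^ℓ - y^ℓ = ∏ (X - ζ^k y)`, Mathlib `X_pow_sub_C_eq_prod`, and primality).
[cite: NeukirchANT1999, Ch. IV §3 (Kummer theory)] -/
theorem exists_sub_pow_mul_mem_of_pow_sub_pow_mem (hℓ : ℓ.Prime) (hζ : IsPrimitiveRoot ζ ℓ)
    {P : Ideal R} [P.IsPrime] {x y : R} (hx : x ^ ℓ - y ^ ℓ ∈ P) : ∃ k < ℓ, x - ζ ^ k * y ∈ P := by
  have hfac := X_pow_sub_C_eq_prod hζ hℓ.pos (rfl : y ^ ℓ = y ^ ℓ)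
  have heval := congrArg (Polynomial.eval x) hfac
  simp only [eval_sub, eval_pow, eval_X, eval_C, eval_prod] at heval
  rw [heval, Ideal.IsPrime.prod_mem_iff] at hx
  obtain ⟨k, hk, hkP⟩ := hx
  exact ⟨k, Finset.mem_range.mp hk, hkP⟩

/-- `x ^ ℓ ≡ 1 (mod 𝔓)` for a prime `𝔓` ⇒ `x ≡ ζ ^ k (mod 𝔓)` for some `k < ℓ` (case `y = 1`).
[cite: NeukirchANT1999, Ch. IV §3 (Kummer theory)] -/
theorem exists_sub_pow_mem_of_pow_sub_one_mem (hℓ : ℓ.Prime) (hζ : IsPrimitiveRoot ζ ℓ)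
    {P : Ideal R} [P.IsPrime] {x : R} (hx : x ^ ℓ - 1 ∈ P) : ∃ k < ℓ, x - ζ ^ k ∈ P := by
  have hx' : x ^ ℓ - 1 ^ ℓ ∈ P := by rwa [one_pow]
  obtain ⟨k, hk, h⟩ := exists_sub_pow_mul_mem_of_pow_sub_pow_mem hℓ hζ hx'
  exact ⟨k, hk, by rwa [mul_one] at h⟩

/-- **Two `ℓ`-th roots of the same element of a domain differ by a root of unity**: `y ^ ℓ = x ^ ℓ`
⇒ `y = ζ ^ k * x` for some `k < ℓ` (evaluate `X^ℓ - x^ℓ = ∏ (X - ζ^k x)` at `y`).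
[cite: NeukirchANT1999, Ch. IV §3 (Kummer theory)] -/
theorem exists_eq_pow_mul_of_pow_eq_pow (hℓ : ℓ.Prime) (hζ : IsPrimitiveRoot ζ ℓ) {x y : R}
    (h : y ^ ℓ = x ^ ℓ) : ∃ k < ℓ, y = ζ ^ k * x := by
  have hfac := X_pow_sub_C_eq_prod hζ hℓ.pos (rfl : x ^ ℓ = x ^ ℓ)
  have heval := congrArg (Polynomial.eval y) hfac
  simp only [eval_sub, eval_pow, eval_X, eval_C, eval_prod] at heval
  rw [h, sub_self] at heval
  obtain ⟨k, hk, hk0⟩ := Finset.prod_eq_zero_iff.mp heval.symm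
  exact ⟨k, Finset.mem_range.mp hk, sub_eq_zero.mp hk0⟩

end RootsOfUnity

/-! ### Kummer characters of `M = N(x_i)` over a field `N ∋ ζ_ℓ` -/

section KummerCharacters

variable {N M : Type*} [Field N] [Field M] [Algebra N M] {ℓ : ℕ} {ζ : N}

/-- **Kummer characters take values in `μ_ℓ(N)`**: for `x ∈ M` with `x ^ ℓ = a ∈ N` and
`σ ∈ Aut(M/N)`, `σ x = ζ ^ k • x` for some `k < ℓ` (`ζ` a primitive `ℓ`-th root of unity in the base
field `N`).  Neukirch, *Algebraic Number Theory*, IV §3 (Kummer theory: `χ_a(σ) = σ(a^{1/n})/a^{1/n}`).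
[cite: NeukirchANT1999, Ch. IV §3 Prop. (3.6)] -/
theorem exists_algEquiv_apply_eq_pow_smul (hℓ : ℓ.Prime) (hζ : IsPrimitiveRoot ζ ℓ)
    {x : M} {a : N} (hx : x ^ ℓ = algebraMap N M a) (σ : M ≃ₐ[N] M) :
    ∃ k < ℓ, σ x = (ζ ^ k) • x := by
  have hζ' : IsPrimitiveRoot (algebraMap N M ζ) ℓ :=
    hζ.map_of_injective (algebraMap N M).injective
  have hpow : (σ x) ^ ℓ = x ^ ℓ := by rw [← map_pow, hx, AlgEquiv.commutes]
  obtain ⟨k, hk, hkx⟩ := exists_eq_pow_mul_of_pow_eq_pow hℓ hζ' hpow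
  exact ⟨k, hk, by rw [hkx, Algebra.smul_def, map_pow]⟩

/-- The exponent `k < ℓ` in `σ x = ζ ^ k • x` is unique when `x ≠ 0`.
[cite: NeukirchANT1999, Ch. IV §3 Prop. (3.6)] -/
theorem eq_of_pow_smul_eq (hζ : IsPrimitiveRoot ζ ℓ) {x : M} (hx : x ≠ 0) {i j : ℕ}
    (hi : i < ℓ) (hj : j < ℓ) (h : (ζ ^ i) • x = (ζ ^ j) • x) : i = j := by
  rw [Algebra.smul_def, Algebra.smul_def] at h
  exact hζ.pow_inj hi hj ((algebraMap N M).injective (mul_right_cancel₀ hx h))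

omit [Field N] [Field M] in
/-- **Multiplicativity of Kummer characters**: if `σ x = c • x` and `τ x = d • x` with `c, d` in
the base then `(σ τ) x = (c d) • x` (the map `σ ↦ σ x / x` is a homomorphism because its values are
fixed by `Aut(M/N)`). [cite: NeukirchANT1999, Ch. IV §3 Prop. (3.6)] -/
theorem mul_apply_eq_mul_smul {N M : Type*} [CommSemiring N] [Semiring M] [Algebra N M]
    {x : M} {σ τ : M ≃ₐ[N] M} {c d : N}
    (hσ : σ x = c • x) (hτ : τ x = d • x) : (σ * τ) x = (c * d) • x := by
  rw [AlgEquiv.mul_apply, hτ, map_smul, hσ, smul_smul, mul_comm]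

/-- **Joint injectivity of the Kummer characters**: an `N`-automorphism of `M = N(x_i : i)` fixing
every generator `x_i` is the identity. [cite: NeukirchANT1999, Ch. IV §3 Prop. (3.6)] -/
theorem algEquiv_eq_one_of_forall_apply_eq {ι : Type*} {x : ι → M}
    (hgen : IntermediateField.adjoin N (Set.range x) = ⊤) {σ : M ≃ₐ[N] M}
    (hσ : ∀ i, σ (x i) = x i) : σ = 1 := by
  refine AlgEquiv.ext fun y => ?_
  have hy : y ∈ IntermediateField.adjoin N (Set.range x) := by rw [hgen]; trivial
  change σ y = y
  induction hy using IntermediateField.adjoin_induction with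
  | mem y hy => obtain ⟨i, rfl⟩ := hy; exact hσ i
  | algebraMap c => exact σ.commutes c
  | add y z _ _ hy hz => rw [map_add, hy, hz]
  | inv y _ hy => rw [map_inv₀, hy]
  | mul y z _ _ hy hz => rw [map_mul, hy, hz]

/-- Two `N`-automorphisms of `M = N(x_i : i)` agreeing on every generator `x_i` are equal.
[cite: NeukirchANT1999, Ch. IV §3 Prop. (3.6)] -/
theorem algEquiv_eq_of_forall_apply_eq {ι : Type*} {x : ι → M}
    (hgen : IntermediateField.adjoin N (Set.range x) = ⊤) {σ τ : M ≃ₐ[N] M}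
    (h : ∀ i, σ (x i) = τ (x i)) : σ = τ := by
  have : τ⁻¹ * σ = 1 :=
    algEquiv_eq_one_of_forall_apply_eq hgen fun i => by
      rw [AlgEquiv.mul_apply, h, ← AlgEquiv.mul_apply, inv_mul_cancel, AlgEquiv.one_apply]
  rwa [inv_mul_eq_one, eq_comm] at this

end KummerCharacters

/-! ### (K2), (K3), (K3′) at a valuation subring: the Γ-level currency of the sub-DAG -/

section Valuation

variable {Ω : Type*} [Field Ω] {G : Type*} [Group G] [MulSemiringAction G Ω]
  (A : ValuationSubring Ω) {ℓ : ℕ} {ζ : Ω}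

omit [MulSemiringAction G Ω] [Group G] in
/-- `v(x ^ ℓ) = 1 ⇒ v(x) = 1` for the valuation of a valuation subring (`ℓ ≠ 0`; the value group
is a linearly ordered group). [folklore] -/
private theorem valuation_eq_one_of_pow {x : Ω} (hℓ : ℓ ≠ 0) (h : A.valuation (x ^ ℓ) = 1) :
    A.valuation x = 1 := by
  rw [map_pow] at h
  exact le_antisymm ((pow_le_one_iff hℓ).mp h.le) ((one_le_pow_iff hℓ).mp h.ge)

/-- **Conjugation transports maximal ideals**: `σ • x ∈ 𝔪_{σ A} ↔ x ∈ 𝔪_A` for the pointwise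
action of ring automorphisms on valuation subrings (`𝔪_A = A.nonunits = {x | x = 0 ∨ x⁻¹ ∉ A}`).
Neukirch, *Algebraic Number Theory*, II §9 (conjugate valuations `𝔓 ↦ σ𝔓`). [cite: NeukirchANT1999, Ch. II §9 Prop. (9.1)] -/
theorem smul_mem_nonunits_smul_iff (σ : G) (x : Ω) :
    σ • x ∈ (σ • A).nonunits ↔ x ∈ A.nonunits := by
  rw [ValuationSubring.mem_nonunits_iff_or, ValuationSubring.mem_nonunits_iff_or, ← smul_inv'',
    ValuationSubring.smul_mem_pointwise_smul_iff, smul_eq_zero_iff_eq]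

/-- For `σ` in the decomposition group `D_A = Stab_G(A)` of a valuation subring `A`, the maximal
ideal `𝔪_A` is `σ`-stable: `σ • x ∈ 𝔪_A ↔ x ∈ 𝔪_A`. [cite: NeukirchANT1999, Ch. II §9 Prop. (9.1)] -/
theorem smul_mem_nonunits_iff_of_mem_stabilizer {σ : G} (hσ : σ ∈ MulAction.stabilizer G A)
    (x : Ω) : σ • x ∈ A.nonunits ↔ x ∈ A.nonunits := by
  conv_lhs => rw [← MulAction.mem_stabilizer_iff.mp hσ]
  exact smul_mem_nonunits_smul_iff A σ x

omit [MulSemiringAction G Ω] [Group G] in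
/-- Multiplication by an element of valuation `1` preserves (non-)membership in `𝔪_A`. [folklore] -/
private theorem mul_mem_nonunits_iff_of_valuation_eq_one {u : Ω} (hu : A.valuation u = 1) (x : Ω) :
    u * x ∈ A.nonunits ↔ x ∈ A.nonunits := by
  rw [ValuationSubring.mem_nonunits_iff, ValuationSubring.mem_nonunits_iff, map_mul, hu, one_mul]

/-- **(K2) Kummer characters, Γ-level**: if `x ^ ℓ = c` and `σ` fixes `c` (e.g. `σ ∈ Gal(Ω/N)` and
`c ∈ N`), then `σ • x = ζ ^ i * x` for some `i < ℓ`, `ζ` a primitive `ℓ`-th root of unity in the field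
`Ω`. [cite: NeukirchANT1999, Ch. IV §3 Prop. (3.6)] -/
theorem exists_smul_eq_pow_mul (hℓ : ℓ.Prime) (hζ : IsPrimitiveRoot ζ ℓ) {σ : G} {x c : Ω}
    (hx : x ^ ℓ = c) (hσc : σ • c = c) : ∃ i < ℓ, σ • x = ζ ^ i * x :=
  exists_eq_pow_mul_of_pow_eq_pow hℓ hζ (by rw [← smul_pow', hx, hσc])

/-- **(K3) FIXEDNESS — the residue formula at a valuation subring.**  Let `G` act on the field `Ω`
by ring automorphisms, `A ⊆ Ω` a valuation subring with `ℓ ∉ 𝔪_A` (`ℓ` prime), `ζ ∈ Ω` a primitive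
`ℓ`-th root of unity, and `σ ∈ D_A = Stab_G(A)` with `σ ζ = ζ`.  If `y ^ ℓ = b` with `σ b = b` and
`b ≡ 1 (mod 𝔪_A)`, then `σ y = y`.  Proof (pure valuation algebra, no Frobenius): `y, ζ ∈ A` are
units; `∏_i (y - ζ^i) = b - 1 ∈ 𝔪_A` gives `y ≡ ζ^i (mod 𝔪_A)`, hence `σ y - y ∈ 𝔪_A` (`𝔪_A` is
`σ`-stable); `σ y = ζ^k y`, so `ζ^k - 1 ∈ 𝔪_A` and `ζ^k = 1` since `ℓ ∉ 𝔪_A`.  This is the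
«Frobenius acts trivially on `a^{1/ℓ}` when `a ≡ 1`» half of the computation of the power-residue /
Kummer symbol at primes not dividing `ℓ` (Neukirch, *Algebraic Number Theory*, V §3 (3.4)–(3.5)).
[cite: NeukirchANT1999, Ch. V §3 Lemma (3.5)] -/
theorem smul_eq_self_of_pow_eq_of_sub_one_mem_nonunits (hℓ : ℓ.Prime)
    (hζ : IsPrimitiveRoot ζ ℓ) {σ : G} (hσ : σ ∈ MulAction.stabilizer G A) (hσζ : σ • ζ = ζ)
    (hℓA : ((ℓ : ℕ) : Ω) ∉ A.nonunits) {y b : Ω} (hy : y ^ ℓ = b) (hσb : σ • b = b)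
    (hb : b - 1 ∈ A.nonunits) : σ • y = y := by
  have hℓ0 : ℓ ≠ 0 := hℓ.ne_zero
  set v := A.valuation with hv
  -- valuations of `b`, `y`, `ζ`
  have hvb : v b = 1 := by
    have := v.map_one_add_of_lt (A.mem_nonunits_iff.mp hb)
    rwa [add_sub_cancel] at this
  have hvy : v y = 1 := valuation_eq_one_of_pow A hℓ0 (by rw [hy, hvb])
  have hvζ : v ζ = 1 := valuation_eq_one_of_pow A hℓ0 (by rw [hζ.pow_eq_one, map_one])
  -- pass to the local domain `A`
  set yA : A := ⟨y, (A.valuation_le_one_iff y).mp hvy.le⟩ with hyA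
  set ζA : A := ⟨ζ, (A.valuation_le_one_iff ζ).mp hvζ.le⟩ with hζA
  have hζA' : IsPrimitiveRoot ζA ℓ :=
    IsPrimitiveRoot.of_map_of_injective (f := A.subtype) (by exact hζ) Subtype.val_injective
  have hℓm : (ℓ : A) ∉ IsLocalRing.maximalIdeal A := fun h =>
    hℓA (by simpa using (ValuationSubring.coe_mem_nonunits_iff.mpr h))
  have h1 : yA ^ ℓ - 1 ∈ IsLocalRing.maximalIdeal A := by
    rw [← ValuationSubring.coe_mem_nonunits_iff]
    simpa [hyA, hy] using hb
  obtain ⟨k, -, hk⟩ := exists_sub_pow_mem_of_pow_sub_one_mem hℓ hζA' h1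
  have hk' : y - ζ ^ k ∈ A.nonunits := by
    simpa [hyA, hζA] using ValuationSubring.coe_mem_nonunits_iff.mpr hk
  -- `σ • y - y ∈ 𝔪_A`
  have hdiff : σ • y - y ∈ A.nonunits := by
    have h2 : σ • (y - ζ ^ k) ∈ A.nonunits := (smul_mem_nonunits_iff_of_mem_stabilizer A hσ _).mpr hk'
    rw [smul_sub, smul_pow', hσζ] at h2
    have := A.nonunits.sub_mem h2 hk'
    rwa [sub_sub_sub_cancel_right] at this
  -- `σ • y = ζ^j y`
  obtain ⟨j, -, hj⟩ := exists_smul_eq_pow_mul hℓ hζ hy hσb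
  have hζj : ζ ^ j - 1 ∈ A.nonunits := by
    rw [hj, ← sub_one_mul, mul_comm, mul_mem_nonunits_iff_of_valuation_eq_one A hvy] at hdiff
    exact hdiff
  have hζjA : ζA ^ j - 1 ∈ IsLocalRing.maximalIdeal A := by
    rw [← ValuationSubring.coe_mem_nonunits_iff]
    simpa [hζA] using hζj
  have hone : ζA ^ j = 1 := pow_eq_one_of_pow_sub_one_mem hℓ hζA' hℓm hζjA
  have hone' : ζ ^ j = 1 := by simpa [hζA] using congrArg Subtype.val hone
  rw [hj, hone', one_mul]

omit [MulSemiringAction G Ω] [Group G] in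
/-- An element of `A` outside `𝔪_A` has valuation `1` (is a unit of `A`). [folklore] -/
private theorem valuation_eq_one_of_mem_of_not_mem_nonunits {b : Ω} (hbA : b ∈ A)
    (hb : b ∉ A.nonunits) : A.valuation b = 1 :=
  le_antisymm ((A.valuation_le_one_iff b).mpr hbA) (not_lt.mp fun h => hb (A.mem_nonunits_iff.mpr h))

/-- **(K3′) MOVING — a Frobenius-type element moves `b^{1/ℓ}` when `b` is not an `ℓ`-th power
residue.**  Let `G` act on the field `Ω` by ring automorphisms and `A ⊆ Ω` be a valuation subring.  If
`y ^ ℓ = b` with `b` a unit of `A` (`b ∈ A`, `b ∉ 𝔪_A`), `φ • y ≡ y ^ q (mod 𝔪_A)` («`φ` acts as the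
`q`-Frobenius on `y`»), `ℓ ∣ q - 1`, and `b ^ ((q-1)/ℓ) ≢ 1 (mod 𝔪_A)` (Euler's criterion: `b` is not
an `ℓ`-th power in the residue field), then `φ • y ≠ y`: otherwise `y ≡ y^q`, i.e. `y^{q-1} ≡ 1` as
`y` is a unit, but `y^{q-1} = b^{(q-1)/ℓ}`.  (Neukirch, *Algebraic Number Theory*, V §3 (3.4)–(3.5):
the power residue symbol `(a/𝔭)_ℓ ≡ a^{(N𝔭-1)/ℓ}`.) [cite: NeukirchANT1999, Ch. V §3 Lemma (3.5)] -/
theorem smul_ne_self_of_sub_pow_mem_nonunits {ℓ : ℕ} (hℓ0 : ℓ ≠ 0) {φ : G} {y b : Ω}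
    (hy : y ^ ℓ = b) (hbA : b ∈ A) (hbu : b ∉ A.nonunits) {q : ℕ} (hq : ℓ ∣ q - 1)
    (hφ : φ • y - y ^ q ∈ A.nonunits) (hb : b ^ ((q - 1) / ℓ) - 1 ∉ A.nonunits) : φ • y ≠ y := by
  intro heq
  apply hb
  rcases Nat.eq_zero_or_pos q with hq0 | hqpos
  · subst hq0
    simp only [Nat.zero_sub, Nat.zero_div, pow_zero, sub_self]
    exact A.nonunits.zero_mem
  have hvy : A.valuation y = 1 :=
    valuation_eq_one_of_pow A hℓ0 (by rw [hy]; exact valuation_eq_one_of_mem_of_not_mem_nonunits A hbA hbu)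
  obtain ⟨m, hm⟩ := hq
  have hqm : q = ℓ * m + 1 := by omega
  have hpow : b ^ ((q - 1) / ℓ) = y ^ (q - 1) := by
    rw [hm, Nat.mul_div_cancel_left m (Nat.pos_of_ne_zero hℓ0), ← hy, ← pow_mul]
  rw [hpow]
  -- `y - y^q = y * (1 - y^(q-1)) ∈ 𝔪_A` and `y` is a unit
  rw [heq] at hφ
  have h1 : y * (1 - y ^ (q - 1)) ∈ A.nonunits := by
    have : y * (1 - y ^ (q - 1)) = y - y ^ q := by
      rw [mul_sub, mul_one, ← pow_succ', Nat.sub_add_cancel hqpos]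
    rwa [this]
  rw [mul_mem_nonunits_iff_of_valuation_eq_one A hvy] at h1
  have := A.nonunits.neg_mem h1
  rwa [neg_sub] at this

end Valuation

/-! ### (K4) Supply of `β`: unit residues of large order and the Chinese remainder theorem -/

section Supply

open NumberField

variable {N : Type*} [Field N] [NumberField N] {ℓ : ℕ} {ζ : 𝓞 N}

/-- **(K4) A unit residue of large order**: if `ℓ` is prime and `ℓ ∣ N𝔮 - 1` for a maximal ideal
`𝔮` of the ring of integers of a number field `N` (`N𝔮 = #(𝓞 N ⧸ 𝔮)`), there is `t ∈ 𝓞 N`, `t ∉ 𝔮`,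
with `t ^ ((N𝔮 - 1)/ℓ) ≢ 1 (mod 𝔮)` — i.e. `t` is not an `ℓ`-th power residue (Euler's criterion):
the unit group of the residue field is cyclic of order `N𝔮 - 1 > (N𝔮 - 1)/ℓ > 0` (Mathlib
`FiniteField.forall_pow_eq_one_iff`). [cite: NeukirchANT1999, Ch. V §3 Lemma (3.5)] -/
theorem exists_pow_div_sub_one_not_mem {q : Ideal (𝓞 N)} [q.IsMaximal] (hℓ : ℓ.Prime)
    (hdvd : ℓ ∣ Nat.card (𝓞 N ⧸ q) - 1) :
    ∃ t : 𝓞 N, t ∉ q ∧ t ^ ((Nat.card (𝓞 N ⧸ q) - 1) / ℓ) - 1 ∉ q := by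
  classical
  letI := Ideal.Quotient.field q
  haveI : Fintype (𝓞 N ⧸ q) := Fintype.ofFinite _
  set n := Nat.card (𝓞 N ⧸ q) - 1 with hn
  set m := n / ℓ with hm
  have hcard : Fintype.card (𝓞 N ⧸ q) = n + 1 := by
    rw [hn, Nat.card_eq_fintype_card, Nat.sub_add_cancel Fintype.card_pos]
  -- `n = ℓ * m`, `0 < m < n`
  have hn1 : 1 ≤ n := by
    have h2 : 1 < Fintype.card (𝓞 N ⧸ q) := Fintype.one_lt_card
    omega
  have hnm : n = ℓ * m := (Nat.mul_div_cancel' hdvd).symm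
  have hm0 : 0 < m := by
    rcases Nat.eq_zero_or_pos m with h | h
    · rw [h, mul_zero] at hnm; omega
    · exact h
  have hmn : ¬ n ∣ m := by
    intro h
    have hle : n ≤ m := Nat.le_of_dvd hm0 h
    have : 2 ≤ ℓ := hℓ.two_le
    nlinarith
  -- a unit of the residue field whose `m`-th power is not `1`
  have hex : ∃ u : (𝓞 N ⧸ q)ˣ, u ^ m ≠ 1 := by
    by_contra! h
    exact hmn (by simpa [hcard] using (FiniteField.forall_pow_eq_one_iff (𝓞 N ⧸ q) m).mp h)
  obtain ⟨u, hu⟩ := hex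
  obtain ⟨t, ht⟩ := Ideal.Quotient.mk_surjective (u : 𝓞 N ⧸ q)
  refine ⟨t, fun htq => u.ne_zero (by rw [← ht, Ideal.Quotient.eq_zero_iff_mem]; exact htq),
    fun hpow => hu ?_⟩
  apply Units.ext
  rw [Units.val_pow_eq_pow_val, ← ht, ← map_pow, Units.val_one, ← map_one (Ideal.Quotient.mk q),
    Ideal.Quotient.eq]
  exact hpow

/-- **(K4) Chinese remainder theorem with targets** in the ring of integers of a number field: for
finitely many pairwise distinct maximal ideals `𝔮 i` and targets `t i` there is `β` with
`β ≡ t i (mod 𝔮 i)` for all `i` (Mathlib `IsDedekindDomain.exists_forall_sub_mem_ideal`).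
[cite: NeukirchANT1999, Ch. I §3 Thm. (3.6)] -/
theorem exists_forall_sub_mem_of_isMaximal {ι : Type*} (s : Finset ι) (𝔮 : ι → Ideal (𝓞 N))
    (hmax : ∀ i ∈ s, (𝔮 i).IsMaximal) (hinj : ∀ i ∈ s, ∀ j ∈ s, i ≠ j → 𝔮 i ≠ 𝔮 j)
    (t : ι → 𝓞 N) : ∃ β : 𝓞 N, ∀ i ∈ s, β - t i ∈ 𝔮 i := by
  have hprime : ∀ i ∈ s, Prime (𝔮 i) := fun i hi =>
    Ideal.prime_of_isPrime (Ring.ne_bot_of_isMaximal_of_not_isField (hmax i hi)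
      (RingOfIntegers.not_isField N)) (hmax i hi).isPrime
  obtain ⟨β, hβ⟩ := IsDedekindDomain.exists_forall_sub_mem_ideal 𝔮 (fun _ => 1) hprime hinj
    (fun i => t i)
  exact ⟨β, fun i hi => by simpa using hβ i hi⟩

omit [NumberField N] in
/-- **(K4) translation**: if the valuation subring `A` of an `N`-algebra `Ω` lies over the ideal `𝔮`
of `𝓞 N` («`x ∈ 𝔮 ↔ x ∈ 𝔪_A`» for `x ∈ 𝓞 N`), then `β ≡ t (mod 𝔮)` gives `β ≡ t (mod 𝔪_A)` in `Ω`.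
[cite: NeukirchANT1999, Ch. II §8 Prop. (8.2)] -/
theorem coe_sub_mem_nonunits_of_sub_mem {Ω : Type*} [Field Ω] [Algebra N Ω]
    (A : ValuationSubring Ω) {q : Ideal (𝓞 N)}
    (hbelow : ∀ x : 𝓞 N, algebraMap N Ω (x : N) ∈ A.nonunits ↔ x ∈ q) {β t : 𝓞 N}
    (h : β - t ∈ q) : algebraMap N Ω (β : N) - algebraMap N Ω (t : N) ∈ A.nonunits := by
  have := (hbelow (β - t)).mpr h
  simpa using this

end Supply

end Literature.NumberTheory.GaloisRepresentations.NeukirchUchidaProof
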